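import Mathlib
import Literature.Analysis.ODE.VariationalEnclosureIntervalTest
import Literature.Analysis.ODE.VariationalEnclosureComposition
import Summits.NavierStokesRegularity.NavierStokesRegularity.Theorems.TaoLadderRungTwoBreakOneShiftWindowTermFieldHom
import Summits.NavierStokesRegularity.NavierStokesRegularity.Theorems.TaoLadderRungTwoBreakOneShiftWindowBoxD
import HarnessLib

/-!
# The one-shift window system, XXVIII: THE CENTRE STEP FROM DYADIC DATA — one Boolean `CentreStepD.check` over
# dyadic interval data (sparse quadratic presentation of the centre field, start box `W`, a-priori box `S`, step
# `h`, candidate `C¹` enclosure `VV`) that, when `true`, yields the centre solution family of the step from the box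
# `W`, its a-priori enclosure in `S`, and the derivative of its time-`τ` map within the box with entries in `VV`
# — the hypotheses `huc`/`huc0`/`hmem`(centre)/`hΦ`/`hΦenc` of part XVI `exists_stepPairSlope` and `hu` of part XXV
# (cell harvest/h2-tao-ladder, seat p2; rung1/KERNEL-CHEAP-REPLAY-SPEC.md §2 (a)–(e), §7 «CHECKER» (a)–(c);
# support for K1(1) = `NoSurvivingDSSOne`, stmt-NavierStokesRegularity-20205)

MODEL lattice ODEs only (Tao 2016 §4 normal form on Tao's shift set `S`); nothing here is a statement about
the Navier–Stokes equations; no item is closed; no instance is evaluated here. Generic in `ι` (numbered by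
`e : ι ≃ Fin n`) and `κ`; COMPUTATIONAL in the sense of referee P162 once an instance's `check` is evaluated by
`native_decide`.

THE COMPUTATION (`CentreStepD.check`, all in the rounded dyadic interval arithmetic `TaylorModelCert.IntervalD`
at `prec` bits): homogenise the boxes (`ext`: slot `n` ≔ `[1,1]`); state jets `jetLevelsA` of the sparse quadratic
`SD` over `W` and over `S` up to order `K` (part XXVI); the all-directions variational tables `varMatLevelsA` from
the identity along both (part XXVI); the powers `[0,h]^j`; the state HOE box `Σ_{j<K} [0,h]^j·Φ_j(W) + [0,h]^K·Φ_K(S)`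
and the test `⊆ S` (Moore 1979 §8.1 (8.10)/(8.13); Nedialkov–Jackson–Pryce 2001 §3); the interval product
`NN = DΦ_K(S)·VV`, the matrix HOE box `Σ_{j<K} [0,h]^j·DΦ_j(W) + [0,h]^K·NN` and the test `⊆ VV` (Walawska–Wilczak
2016 §2.1); well-formedness of `W`, `VV`, `NN`, strict well-formedness of `S`, `0 < K`, `0 ≤ h`.

THE THEOREM (`CentreStepD.sound`): if `SD` presents the homogenised centre field `homQ T e` (part XXVII
`IsSQEnclosure`) and `check = true`, then with `W`, `S` read as real boxes (`boxOf`) and `h = hD`: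
(i) every `x ∈ W` starts a solution of `x' = termField T x` on `[0, h]`, and EVERY solution from `x` stays in `S`
(Literature `highOrderEnclosure_step_smooth` fed by parts XXVI/XXVII); (ii) the resulting family `uc` is an
`IsSolutionFamily`; (iii) for every `x ∈ W`, `τ ∈ [0, h]` the map `x' ↦ uc x' τ` has a derivative within `boxSet W`
at `x` whose `(i, l)` entry lies in `VV[e i][e l]` (Literature `hasFDerivWithinAt_flow_of_variationalEnclosure_smoothOn_local`,
its semantic hypotheses `hincl`/`hKS`/`hKN`/`hinclV` discharged by interval-arithmetic soundness). No wrapping-effect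
control (QR / parallelepipeds) is needed at this level: `VV` is emitted data, only CHECKED here.
-/

-- the sub-problem namespace repeats the summit name by design (D-0017)
set_option linter.dupNamespace false

namespace Summit.NavierStokesRegularity.NavierStokesRegularity.Theorems

namespace DSSOneShift

open Set Finset Metric TopologicalSpace
open Literature.Analysis.ODE
open Summit.NavierStokesRegularity.NavierStokesRegularity.Theorems.TaylorModelCert
open Summit.NavierStokesRegularity.NavierStokesRegularity.Theorems.TaylorModelReadout
open Summit.NavierStokesRegularity.NavierStokesRegularity.Theorems.CertificateGlueOn
open scoped ContDiff

/-! ### The dyadic data of a centre step and its Boolean test -/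

/-- **The dyadic data of one centre step**: precision, order `K`, dimension `n`, the sparse quadratic
presentation `SD` of the homogenised centre field (on `n+1` slots), the start box `W`, the a-priori box `S`
(physical slots, read by `aget`), the step `hD`, and the candidate `C¹` enclosure `VV` (entry `(i,l)` at `l·n + i`).
[cite: WalawskaWilczak2016, §2.1; cell vocabulary, harvest/h2-tao-ladder rung1/KERNEL-CHEAP-REPLAY-SPEC.md §1/§2] -/
structure CentreStepD where
  /-- mantissa bits of the outward rounding -/
  prec : ℕ
  /-- Taylor order -/
  K : ℕ
  /-- number of physical coordinates -/
  n : ℕ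
  /-- sparse quadratic presentation of the homogenised centre field -/
  SD : SQRows
  /-- start box -/
  W : Array IntervalD
  /-- a-priori (rough) box -/
  S : Array IntervalD
  /-- step length -/
  hD : Dyad
  /-- candidate C¹ enclosure, column-major -/
  VV : Array IntervalD

namespace CentreStepD

variable (d : CentreStepD)

/-- Homogenise a physical box: slot `n` ≔ `[1, 1]`. [folklore] -/
def ext (A : Array IntervalD) : Array IntervalD :=
  Array.ofFn fun c : Fin (d.n + 1) => if (c : ℕ) < d.n then IntervalD.aget A c else IntervalD.ofInt 1

/-- The step interval `[0, h]`. [folklore] -/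
def TD : IntervalD := ⟨Dyad.ofInt 0, d.hD⟩

/-- The powers `[0,h]^j`, `j ≤ K`. [folklore] -/
def pows : Array IntervalD := Array.ofFn fun j : Fin (d.K + 1) => IntervalD.powR d.prec d.TD j

/-- State jets over a (homogenised) box. [folklore] -/
def jets (A : Array IntervalD) : Array (Array IntervalD) :=
  IntervalD.jetLevelsA (d.n + 1) (sqEvalA (d.n + 1) d.prec d.SD) d.prec (d.ext A) d.K

/-- The all-directions variational table along given state levels. [folklore] -/
def vars (Ls : Array (Array IntervalD)) : Array (Array IntervalD) :=
  varMatLevelsA (d.n + 1) d.prec (jacLevelsA (sqJacA (d.n + 1) d.prec d.SD) Ls d.K) (idBoxA (d.n + 1)) d.K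

/-- The state HOE box `Σ_{j<K} [0,h]^j · Φ_j(W)_c + [0,h]^K · Φ_K(S)_c`. [cite: Moore1979, §8.1 eq. (8.10); NedialkovJacksonPryce2001, §3] -/
def hoeState (JW JS : Array (Array IntervalD)) (c : ℕ) : IntervalD :=
  IntervalD.addR d.prec
    (IntervalD.rangeSumR d.prec (fun j => IntervalD.mulR d.prec (IntervalD.aget d.pows j)
      (IntervalD.aget (IntervalD.lget JW j) c)) d.K)
    (IntervalD.mulR d.prec (IntervalD.aget d.pows d.K) (IntervalD.aget (IntervalD.lget JS d.K) c))

/-- Entry `(i,l)` of level `j` of a variational table (physical block). [folklore] -/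
def ev (V : Array (Array IntervalD)) (j i l : ℕ) : IntervalD :=
  IntervalD.aget (IntervalD.lget V j) (l * (d.n + 1) + i)

/-- Entry `(i,l)` of the candidate `C¹` enclosure. [folklore] -/
def vv (i l : ℕ) : IntervalD := IntervalD.aget d.VV (l * d.n + i)

/-- Entry `(i,l)` of `NN = DΦ_K(S) · VV`. [cite: Neumaier1991, §3.1 Proposition 3.1.2 (6)] -/
def nn (VS : Array (Array IntervalD)) (i l : ℕ) : IntervalD :=
  IntervalD.rangeSumR d.prec (fun j => IntervalD.mulR d.prec (d.ev VS d.K i j) (d.vv j l)) d.n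

/-- `NN` materialised, column-major. [folklore] -/
def nnA (VS : Array (Array IntervalD)) : Array IntervalD :=
  Array.ofFn fun t : Fin (d.n * d.n) => d.nn VS (t.val % d.n) (t.val / d.n)

/-- The matrix HOE box `Σ_{j<K} [0,h]^j · DΦ_j(W)_{il} + [0,h]^K · NN_{il}`. [cite: WalawskaWilczak2016, §2.1 (the test for [Ṽ])] -/
def hoeMat (VW : Array (Array IntervalD)) (NN : Array IntervalD) (i l : ℕ) : IntervalD :=
  IntervalD.addR d.prec
    (IntervalD.rangeSumR d.prec (fun j => IntervalD.mulR d.prec (IntervalD.aget d.pows j) (d.ev VW j i l)) d.K)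
    (IntervalD.mulR d.prec (IntervalD.aget d.pows d.K) (IntervalD.aget NN (l * d.n + i)))

/-- The test on given tables. [folklore] -/
def checkWith (JW JS VW : Array (Array IntervalD)) (NN : Array IntervalD) : Bool :=
  decide (0 < d.K) && Dyad.ble (Dyad.ofInt 0) d.hD &&
  (List.range d.n).all (fun c =>
    wfD (IntervalD.aget d.W c) && wfsD (IntervalD.aget d.S c) && IntervalD.subset (d.hoeState JW JS c) (IntervalD.aget d.S c)) &&
  (List.range d.n).all (fun i => (List.range d.n).all (fun l =>
    wfD (d.vv i l) && wfD (IntervalD.aget NN (l * d.n + i)) && IntervalD.subset (d.hoeMat VW NN i l) (d.vv i l)))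

/-- **THE CENTRE-STEP TEST.** [cite: WalawskaWilczak2016, §2.1; Moore1979, §8.1 eq. (8.13)] -/
def check : Bool :=
  let JW := d.jets d.W
  let JS := d.jets d.S
  let VW := d.vars JW
  let VS := d.vars JS
  d.checkWith JW JS VW (d.nnA VS)

/-- `check` unfolded. [folklore] -/
theorem check_eq : d.check = d.checkWith (d.jets d.W) (d.jets d.S) (d.vars (d.jets d.W)) (d.nnA (d.vars (d.jets d.S))) :=
  rfl

/-! ### Unpacking the Boolean -/

/-- What `checkWith = true` says. [folklore] -/
theorem of_checkWith {JW JS VW : Array (Array IntervalD)} {NN : Array IntervalD} (h : d.checkWith JW JS VW NN = true) :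
    0 < d.K ∧ 0 ≤ d.hD.toReal ∧
    (∀ c < d.n, wfD (IntervalD.aget d.W c) = true ∧ wfsD (IntervalD.aget d.S c) = true ∧
      IntervalD.subset (d.hoeState JW JS c) (IntervalD.aget d.S c) = true) ∧
    (∀ i < d.n, ∀ l < d.n, wfD (d.vv i l) = true ∧ wfD (IntervalD.aget NN (l * d.n + i)) = true ∧
      IntervalD.subset (d.hoeMat VW NN i l) (d.vv i l) = true) := by
  unfold checkWith at h
  simp only [Bool.and_eq_true, List.all_eq_true, List.mem_range, decide_eq_true_eq] at h
  obtain ⟨⟨⟨hK, hh⟩, hc⟩, hm⟩ := h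
  refine ⟨hK, ?_, fun c hc' => ?_, fun i hi l hl => ?_⟩
  · have := (Dyad.ble_iff _ _).1 hh; simpa using this
  · exact ⟨(hc c hc').1.1, (hc c hc').1.2, (hc c hc').2⟩
  · exact ⟨((hm i hi) l hl).1.1, ((hm i hi) l hl).1.2, ((hm i hi) l hl).2⟩

/-! ### Reading the homogenised boxes -/

/-- Physical slots of `ext`. [folklore] -/
theorem aget_ext_of_lt (A : Array IntervalD) {c : ℕ} (hc : c < d.n) :
    IntervalD.aget (d.ext A) c = IntervalD.aget A c := by
  unfold ext; rw [IntervalD.aget_ofFn _ (Nat.lt_succ_of_lt hc)]; exact if_pos hc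

/-- The last slot of `ext` is `[1, 1]`. [folklore] -/
theorem aget_ext_last (A : Array IntervalD) : IntervalD.aget (d.ext A) d.n = IntervalD.ofInt 1 := by
  unfold ext; rw [IntervalD.aget_ofFn _ (Nat.lt_succ_self _)]; exact if_neg (lt_irrefl _)

/-- `ext` has size `n+1`. [folklore] -/
theorem size_ext (A : Array IntervalD) : (d.ext A).size = d.n + 1 := by simp [ext]

/-- A point of the real box of a well-formed array lies, homogenised, in `ext`. [folklore] -/
theorem hboxMem_of_mem_boxOf {ι : Type*} (e : ι ≃ Fin d.n) {A : Array IntervalD}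
    (hwf : ∀ c < d.n, wfD (IntervalD.aget A c) = true) {x : ι → ℝ} (hx : x ∈ boxSet (boxOf e A)) :
    HBoxMem e (d.ext A) x := by
  refine ⟨fun c hc => ?_, ?_⟩
  · rw [d.aget_ext_of_lt A hc]
    have h := (mem_boxSet_iff.1 hx) (e.symm ⟨c, hc⟩)
    simp only [boxOf, Equiv.apply_symm_apply] at h
    exact mem_of_mem_toNI (hwf c hc) h
  · rw [d.aget_ext_last]; exact_mod_cast IntervalD.mem_ofInt 1

/-- Powers of the step interval. [folklore] -/
theorem mem_pows {t : ℝ} (ht : t ∈ Icc 0 d.hD.toReal) {j : ℕ} (hj : j ≤ d.K) :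
    IntervalD.mem (t ^ j) (IntervalD.aget d.pows j) := by
  unfold pows
  rw [IntervalD.aget_ofFn _ (Nat.lt_succ_of_le hj)]
  refine IntervalD.mem_powR d.prec ⟨?_, ht.2⟩ j
  show (Dyad.ofInt 0).toReal ≤ t
  simpa using ht.1

/-! ### Soundness -/

section Sound

variable {ι : Type*} [Fintype ι] [DecidableEq ι] {κ : Type*} [Fintype κ]

/-- **SOUNDNESS OF THE CENTRE-STEP TEST.** See the module docstring. [cite: WalawskaWilczak2016, §2.1 and §2.2 Lemma 2; Moore1979, §8.1 eqs. (8.10), (8.13); NedialkovJacksonPryce2001, §3] -/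
theorem sound (T : κ → BTerm ι) (e : ι ≃ Fin d.n) (hSD : IsSQEnclosure (homQ T e) d.SD) (hc : d.check = true) :
    ∃ uc : (ι → ℝ) → ℝ → ι → ℝ,
      IsSolutionFamily (termField T) (boxSet (boxOf e d.S)) (boxSet (boxOf e d.W)) d.hD.toReal uc ∧
      (∀ z : ℝ → ι → ℝ, z 0 ∈ boxSet (boxOf e d.W) →
        (∀ t ∈ Icc 0 d.hD.toReal, HasDerivWithinAt z (termField T (z t)) (Icc 0 d.hD.toReal) t) →
        ∀ t ∈ Icc 0 d.hD.toReal, z t ∈ boxSet (boxOf e d.S)) ∧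
      (∀ x ∈ boxSet (boxOf e d.W), ∀ τ ∈ Icc 0 d.hD.toReal, ∃ J : (ι → ℝ) →L[ℝ] (ι → ℝ),
        HasFDerivWithinAt (fun x' => uc x' τ) J (boxSet (boxOf e d.W)) x ∧
        ∀ i l, (d.vv (e i) (e l)).lo.toReal ≤ J (Pi.single l 1) i ∧ J (Pi.single l 1) i ≤ (d.vv (e i) (e l)).hi.toReal) := by
  classical
  -- names
  set JW := d.jets d.W with hJW
  set JS := d.jets d.S with hJS
  set VW := d.vars JW with hVW
  set VS := d.vars JS with hVS
  set NN := d.nnA VS with hNN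
  rw [check_eq] at hc
  obtain ⟨hK, hh, hcS, hcM⟩ := d.of_checkWith hc
  set h := d.hD.toReal with hhdef
  set Wr := boxOf e d.W with hWr
  set Sr := boxOf e d.S with hSr
  have hwfW : ∀ c < d.n, wfD (IntervalD.aget d.W c) = true := fun c hc => (hcS c hc).1
  have hwfS : ∀ c < d.n, wfD (IntervalD.aget d.S c) = true := fun c hc => wfD_of_wfsD (hcS c hc).2.1
  -- the field and its Taylor data
  have hf : ContDiff ℝ ∞ (termField T) := (contDiff_termField T).of_le le_top
  have hfOn : ContDiffOn ℝ ∞ (termField T) ((⊤ : Opens (ι → ℝ)) : Set (ι → ℝ)) := termField_contDiffOn T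
  have ePhi : ∀ j, smoothTaylorMap (Ω := ⊤) hfOn j = tjet T j := fun j => rfl
  have ePhi' : ∀ j x v, smoothTaylorFDeriv (Ω := ⊤) hfOn j x v = vjet T j x v := fun j x v => rfl
  -- (F3) state jets over W and S
  have hjetW : ∀ x ∈ boxSet Wr, ∀ j ≤ d.K, ∀ i, IntervalD.mem (tjet T j x i) (IntervalD.aget (IntervalD.lget JW j) (e i)) := by
    intro x hx j hj i
    have hm : IntervalD.mem (tjet T j x (e.symm ⟨(e i : ℕ), (e i).isLt⟩)) (IntervalD.aget (IntervalD.lget JW j) (e i)) :=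
      mem_tjet_of_jetLevelsA T e hSD d.prec d.K (d.size_ext d.W) (d.hboxMem_of_mem_boxOf e hwfW hx) hj (e i).isLt
    simpa using hm
  have hjetS : ∀ z ∈ boxSet Sr, ∀ j ≤ d.K, ∀ i, IntervalD.mem (tjet T j z i) (IntervalD.aget (IntervalD.lget JS j) (e i)) := by
    intro z hz j hj i
    have hm : IntervalD.mem (tjet T j z (e.symm ⟨(e i : ℕ), (e i).isLt⟩)) (IntervalD.aget (IntervalD.lget JS j) (e i)) :=
      mem_tjet_of_jetLevelsA T e hSD d.prec d.K (d.size_ext d.S) (d.hboxMem_of_mem_boxOf e hwfS hz) hj (e i).isLt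
    simpa using hm
  -- (F4) variational jets over W and S
  have hvarW : ∀ x ∈ boxSet Wr, ∀ j ≤ d.K, ∀ i l, IntervalD.mem (vjet T j x (Pi.single l 1) i) (d.ev VW j (e i) (e l)) := by
    intro x hx j hj i l
    exact mem_vjet_single_of_varMatLevelsA T e hSD d.prec d.K
      (mem_hjet_of_jetLevelsA T e hSD d.prec d.K (d.size_ext d.W) (d.hboxMem_of_mem_boxOf e hwfW hx)) hj i l
  have hvarS : ∀ z ∈ boxSet Sr, ∀ j ≤ d.K, ∀ i l, IntervalD.mem (vjet T j z (Pi.single l 1) i) (d.ev VS j (e i) (e l)) := by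
    intro z hz j hj i l
    exact mem_vjet_single_of_varMatLevelsA T e hSD d.prec d.K
      (mem_hjet_of_jetLevelsA T e hSD d.prec d.K (d.size_ext d.S) (d.hboxMem_of_mem_boxOf e hwfS hz)) hj i l
  -- the remainder boxes
  set c : ι → ℝ := fun i => (IntervalD.aget (IntervalD.lget JS d.K) (e i)).lo.toReal with hcdef
  set dd : ι → ℝ := fun i => (IntervalD.aget (IntervalD.lget JS d.K) (e i)).hi.toReal with hdddef
  have hKS : MapsTo (smoothTaylorMap (Ω := ⊤) hfOn d.K) (boxSet Sr) (Icc c dd) := by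
    intro z hz
    rw [ePhi]
    exact ⟨fun i => (hjetS z hz d.K le_rfl i).1, fun i => (hjetS z hz d.K le_rfl i).2⟩
  have hSne : boxLo Sr ∈ boxSet Sr := left_mem_Icc.2 (boxLo_le_boxHi Sr)
  have hcd : c ≤ dd := by
    have hz := hKS hSne
    exact fun i => (hz.1 i).trans (hz.2 i)
  -- hincl
  have hincl : ∀ y₀ ∈ boxSet Wr, ∀ t ∈ Icc 0 h, ∀ v ∈ Icc c dd,
      (∑ j ∈ Finset.range d.K, t ^ j • smoothTaylorMap (Ω := ⊤) hfOn j y₀) + t ^ d.K • v ∈ boxSet Sr := by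
    intro y₀ hy₀ t ht v hv
    rw [mem_boxSet_iff]
    intro i
    refine mem_toNI (IntervalD.mem_of_subset (hcS (e i) (e i).isLt).2.2 ?_)
    simp only [Pi.add_apply, Finset.sum_apply, Pi.smul_apply, smul_eq_mul, ePhi]
    refine IntervalD.mem_addR d.prec (IntervalD.mem_rangeSumR d.prec d.K fun j hj => ?_) ?_
    · exact IntervalD.mem_mulR d.prec (d.mem_pows ht (le_of_lt hj)) (hjetW y₀ hy₀ j (le_of_lt hj) i)
    · exact IntervalD.mem_mulR d.prec (d.mem_pows ht le_rfl) ⟨hv.1 i, hv.2 i⟩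
  -- (i) existence and enclosure from the C⁰ theorem
  have hC0 : ∀ y₀ ∈ boxSet Wr,
      (∃ y : ℝ → ι → ℝ, y 0 = y₀ ∧ ∀ t ∈ Icc 0 h, HasDerivWithinAt y (termField T (y t)) (Icc 0 h) t) ∧
      ∀ z : ℝ → ι → ℝ, z 0 = y₀ → (∀ t ∈ Icc 0 h, HasDerivWithinAt z (termField T (z t)) (Icc 0 h) t) →
        ∀ t ∈ Icc 0 h, z t ∈ boxSet Sr := by
    intro y₀ hy₀
    have H := highOrderEnclosure_step_smooth hf hK (S := boxSet Sr) (W := boxSet Wr) (isBounded_boxSet Sr)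
      (convex_boxSet Sr) hcd hKS hh hincl hy₀
    exact ⟨H.1, fun z hz0 hz t ht => (H.2 z hz0 hz t ht).1⟩
  -- the centre family
  let uc : (ι → ℝ) → ℝ → ι → ℝ := fun y₀ => if hy : y₀ ∈ boxSet Wr then Classical.choose (hC0 y₀ hy).1 else fun _ => y₀
  have huc_spec : ∀ y₀ (hy : y₀ ∈ boxSet Wr), uc y₀ 0 = y₀ ∧
      ∀ t ∈ Icc 0 h, HasDerivWithinAt (uc y₀) (termField T (uc y₀ t)) (Icc 0 h) t := by
    intro y₀ hy
    have e1 : uc y₀ = Classical.choose (hC0 y₀ hy).1 := dif_pos hy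
    rw [e1]
    exact Classical.choose_spec (hC0 y₀ hy).1
  have hu : IsSolutionFamily (termField T) (boxSet Sr) (boxSet Wr) h uc :=
    { init := fun y hy => (huc_spec y hy).1
      hasDerivWithinAt := fun y hy => (huc_spec y hy).2
      mem := fun y hy t ht => (hC0 y hy).2 (uc y) (huc_spec y hy).1 (huc_spec y hy).2 t ht }
  -- the C¹ data
  set CV : ι → ι → ℝ := fun i l => (d.vv (e i) (e l)).lo.toReal with hCV
  set DV : ι → ι → ℝ := fun i l => (d.vv (e i) (e l)).hi.toReal with hDV
  set CN : ι → ι → ℝ := fun i l => (IntervalD.aget NN ((e l : ℕ) * d.n + (e i : ℕ))).lo.toReal with hCN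
  set DN : ι → ι → ℝ := fun i l => (IntervalD.aget NN ((e l : ℕ) * d.n + (e i : ℕ))).hi.toReal with hDN
  have hCDN : CN ≤ DN := fun i l => (Dyad.ble_iff _ _).1 (hcM (e i) (e i).isLt (e l) (e l).isLt).2.1
  -- NN entries enclose (DΦ_K(z) ∘ M) for z ∈ S, M ∈ [CV, DV]
  have hNNmem : ∀ z ∈ boxSet Sr, ∀ M : (ι → ℝ) →L[ℝ] (ι → ℝ),
      (fun i j => M (Pi.single j 1) i) ∈ Icc CV DV → ∀ i l,
      IntervalD.mem ((smoothTaylorFDeriv (Ω := ⊤) hfOn d.K z).comp M (Pi.single l 1) i)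
        (IntervalD.aget NN ((e l : ℕ) * d.n + (e i : ℕ))) := by
    intro z hz M hM i l
    have hflat : (e l : ℕ) * d.n + (e i : ℕ) < d.n * d.n ∧ ((e l : ℕ) * d.n + (e i : ℕ)) / d.n = (e l : ℕ) ∧
        ((e l : ℕ) * d.n + (e i : ℕ)) % d.n = (e i : ℕ) :=
      ⟨by nlinarith [Nat.mul_le_mul_right d.n (Nat.succ_le_of_lt (e l).isLt), (e i).isLt],
        by rw [add_comm, Nat.add_mul_div_right _ _ (Nat.zero_lt_of_lt (e i).isLt), Nat.div_eq_of_lt (e i).isLt, zero_add],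
        by rw [add_comm, Nat.add_mul_mod_self_right, Nat.mod_eq_of_lt (e i).isLt]⟩
    obtain ⟨h1, h2, h3⟩ := hflat
    rw [hNN]
    unfold nnA
    rw [IntervalD.aget_ofFn _ h1]
    dsimp only
    rw [h2, h3, clm_comp_apply_single]
    unfold nn
    refine mem_sum_equiv e d.prec fun k hk => ?_
    refine IntervalD.mem_mulR d.prec ?_ ?_
    · have hm := hvarS z hz d.K le_rfl i (e.symm ⟨k, hk⟩)
      simp only [Equiv.apply_symm_apply] at hm
      rw [ePhi']
      exact hm
    · have hlo := hM.1 (e.symm ⟨k, hk⟩) l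
      have hhi := hM.2 (e.symm ⟨k, hk⟩) l
      simp only [hCV, hDV, Equiv.apply_symm_apply] at hlo hhi
      exact ⟨hlo, hhi⟩
  have hKN : ∀ z ∈ boxSet Sr, ∀ M : (ι → ℝ) →L[ℝ] (ι → ℝ), (fun i j => M (Pi.single j 1) i) ∈ Icc CV DV →
      (fun i j => (smoothTaylorFDeriv (Ω := ⊤) hfOn d.K z).comp M (Pi.single j 1) i) ∈ Icc CN DN := by
    intro z hz M hM
    exact ⟨fun i l => (hNNmem z hz M hM i l).1, fun i l => (hNNmem z hz M hM i l).2⟩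
  have hinclV : ∀ x ∈ boxSet Wr, ∀ t ∈ Icc 0 h, ∀ N : (ι → ℝ) →L[ℝ] (ι → ℝ),
      (fun i j => N (Pi.single j 1) i) ∈ Icc CN DN →
      (fun i j => ((∑ k ∈ Finset.range d.K, t ^ k • smoothTaylorFDeriv (Ω := ⊤) hfOn k x) + t ^ d.K • N)
        (Pi.single j 1) i) ∈ Icc CV DV := by
    intro x hx t ht N hN
    have hent : ∀ i l, IntervalD.mem (((∑ k ∈ Finset.range d.K, t ^ k • smoothTaylorFDeriv (Ω := ⊤) hfOn k x) +
        t ^ d.K • N) (Pi.single l 1) i) (d.vv (e i) (e l)) := by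
      intro i l
      refine IntervalD.mem_of_subset (hcM (e i) (e i).isLt (e l) (e l).isLt).2.2 ?_
      simp only [_root_.add_apply, _root_.sum_apply, _root_.smul_apply, Finset.sum_apply, Pi.smul_apply,
        Pi.add_apply, smul_eq_mul, ePhi']
      refine IntervalD.mem_addR d.prec (IntervalD.mem_rangeSumR d.prec d.K fun j hj => ?_) ?_
      · exact IntervalD.mem_mulR d.prec (d.mem_pows ht (le_of_lt hj)) (hvarW x hx j (le_of_lt hj) i l)
      · exact IntervalD.mem_mulR d.prec (d.mem_pows ht le_rfl) ⟨hN.1 i l, hN.2 i l⟩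
    exact ⟨fun i l => (hent i l).1, fun i l => (hent i l).2⟩
  have hSu : UniqueDiffOn ℝ (boxSet Sr) :=
    uniqueDiffOn_boxSet fun i => toNI_fst_lt_snd (hcS (e i) (e i).isLt).2.1
  -- (iii) the derivative within the box
  refine ⟨uc, hu, fun z hz0 hz t ht => (hC0 (z 0) hz0).2 z rfl hz t ht, fun x hx τ hτ => ?_⟩
  obtain ⟨J, hJ, hJenc, -⟩ := hasFDerivWithinAt_flow_of_variationalEnclosure_smoothOn_local hfOn hK
    (S := boxSet Sr) (W := boxSet Wr) (fun _ _ => trivial) (isCompact_Icc) (convex_boxSet Sr) hSu hcd hKS hCDN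
    hKN hh hincl hinclV hu hx hτ
  exact ⟨J, hJ, fun i l => ⟨hJenc.1 i l, hJenc.2 i l⟩⟩

end Sound

end CentreStepD

end DSSOneShift

end Summit.NavierStokesRegularity.NavierStokesRegularity.Theorems
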